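import Summits.QuantumFields.YangMills.Theorems.UV3ACLargeFieldEnvelopeAtLevel
import Summits.QuantumFields.YangMills.Theorems.AlphaInputsT3ACv4CoreRows
import HarnessLib

/-!
# `UV3ACLargeFieldEnvelopeRows` — R3 (cell `ym3-torus`, YM₃ on T³ — a ladder RUNG, NOT d = 4, NOT infinite volume, NOT a mass gap, NOT the Clay problem):
# **THE (41)_k LARGE-FIELD HISTORY SUM IS K-UNIFORMLY ESSENTIALLY BOUNDED AT EVERY LEVEL — ROWS EDITION**, over the version-agnostic rows record
# `AlphaInputsT3AC.PkgCoreRows` (★★OWNER RULING g26-№14 (F-2b) «generalise once»), i.e. for BOTH the v3 packages and the v4 χ-packages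

Width seat `ym3-torus-px8` g15 ((C) census `CENSUS-V3-SOCKET-ROWS-px8g15.md`, 19936 evidence #42: the v3 socket's rows L-67 `hLF67` ∕ A-2 `fibre57Low` have no supplier of
record; the suppliers of record {EX, (O‴χₛ)} deliver the v4 χ-socket, and both versions project to `PkgCoreRows`).  THEOREMS ONLY (0 `def`, 0 `sorry`, default heartbeats);
`--supports stmt-QuantumFields-20520 --as helper`; count-neutral.  CONDITIONAL on a rows record `p : AlphaInputsT3AC.PkgCoreRows F 𝔠 γ hγ hγ1 K` (fed by ✓`PkgAtV3.toCore` +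
✓`PkgCoreV3.toRows` from the v3 socket and by ✓`PkgAtV4Chi.toRows` from the v4 χ-socket `AlphaInputsT3AC.OfV4ChiAt` ∕ `AlphaInputsT3ACv4RecChi`, all OPEN); nothing of
[Balaban1985UV3] is asserted.

WHAT CHANGES w.r.t. the v3 edition ✓`UV3ACLargeFieldEnvelopeAtLevel` (px8 g15, p767460): the ONLY (α)-row read by the resummation is the small-factors leaf (67)–(71) on
admissible histories; the v3 edition derived it from the comb (67)-row `hLF67` + (68) (✓`smallFactorsAdm_towerOfAC_v3` over ✓`AlphaV3AC.eq71_perPlaquette_of_alphaV3`); here it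
is read from the CURRENCY-FREE (71)-row `AlphaV4AC.RunAlphaV4CoreAC.h71` — (71) per recorded large-field plaquette — which is the run row of the rows record (`p.runRows`,
✓`PkgCoreRows.smallFactor71`) and, in the χₛ-display of record, a THEOREM of class membership (✓`AlphaInputsT3AC.smallFactor71OfRecT3_of_gamma0_dL_cast`).  Everything else
(the booked Z-terms ✓`Zterm_towerOfAC_le_booked`, the counted collars, the provisos, the level-`k` mass envelope ✓`massRecP_avT3_le_exp_ae_of_level`) is version-free and IMPORTED.
* §1 ★ `smallFactorsAdm_towerOfAC_v4Core` — lane-generic: `RunAlphaV4CoreAC ⇒ adm h → (1∕(4N))·Σ_{e∈P(h)} p(g_{e.1})²∕4 ≤ mainT_k(h, U)` (multiplicity `≤ 4` of the regions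
  ✓`card_filter_regionT_le_four'`, double counting ✓`LargeFieldKnit.sum_sum_mem_le_mul_sum`); T³ reading `smallFactorsAdm_of_coreRows`.
* §2 ★★★ `all_le_of_massEnvelope_rows_at`, ★★★ `lfSum_le_exp_ae_of_massEnvelope_rows`, ★★★ `exists_lfSum_le_exp_ae_rows` — the v3 edition's §2 VERBATIM over `PkgCoreRows`:
  for every `k ≤ K`, `dU_k`-a.e. in `W`, `Σ_r wtP_k(r, W)·exp(−mainT_k(r, W) + Zterm_k(r)) ≤ exp(#PBond(F.P K) k·A + (3∕(½ log L))·#Site(F.P K, k))`, ONE `A ≥ 0` per family.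
* §3 `exists_lfSum_le_exp_ae_v4Chi` — the same read at the v4 χ-package `AlphaInputsT3AC.PkgAtV4Chi` (`.toRows`), the package the 19936 registry's stubs deliver.
HONEST SCOPE.  Bookkeeping over landed theorems; conditional on the rows record; nothing of (5)∕(41)∕(47), ⟨UP⟩, PERS₁∘, 20520, 19936, the rung, d = 4, a mass gap or Clay is
proved here; the Yang–Mills mass gap is NOT proved.

References: T. Bałaban, Commun. Math. Phys. **102** (1985) 255–275 [Balaban1985UV3] ((5) p.256, (39)–(41) p.266, (67)–(71) p.273, pp.273–274).
-/

set_option autoImplicit false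

noncomputable section

namespace Summit.QuantumFields.YangMills.Theorems.UV3ACLargeFieldEnvelopeRows

open MeasureTheory
open scoped BigOperators ENNReal
open Literature.MathematicalPhysics.QuantumFieldTheory.Balaban1983to89
open Literature.MathematicalPhysics.QuantumFieldTheory.Balaban1983to89.B10LargeField (xlog one_le_xlog xlog_gRun)
open Literature.MathematicalPhysics.QuantumFieldTheory.Balaban1983to89.T3ContinuumYM3Torus
open Literature.MathematicalPhysics.QuantumFieldTheory.Balaban1983to89.T3UnitLawDensityEML (ℰp)
open Literature.MathematicalPhysics.QuantumFieldTheory.Balaban1985CMP102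
open Literature.MathematicalPhysics.QuantumFieldTheory.Balaban1985CMP102.Setting
open Summit.QuantumFields.Balaban3D.Carriers
open Summit.QuantumFields.Balaban3D.Proofs.Primitives
open Summit.QuantumFields.Balaban3D.Proofs.ScalesArithmetic (gk_pos gk_le_one g0sq_pos gk_eq_gRun_norm)
open Summit.QuantumFields.Balaban3D.Proofs.GroupModelLieC (lieC)
open Summit.QuantumFields.Balaban3D.Proofs.Family (prov_hb₁ prov_hb₂ prov_hp)
open Summit.QuantumFields.Balaban3D.Proofs.TowerAC
open Summit.QuantumFields.Balaban3D.Proofs.StandardAC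
open Summit.QuantumFields.Balaban3D.Proofs.InputsAC
open Summit.QuantumFields.Balaban3D.Proofs.Run3SmallFactors (regionT)
open Summit.QuantumFields.Balaban3D.Proofs.HistCount (card_filter_allCodes_le_exp)
open Summit.QuantumFields.Balaban3D.Proofs.LargeFieldKnit (sum_sum_mem_le_mul_sum)
open Summit.QuantumFields.Balaban3D.Proofs.AlphaAC (AlphaDataAC)
open Summit.QuantumFields.YangMills.Theorems.UV3LargeFieldEnvelopedResummation (largeField_enveloped_adm)
open Summit.QuantumFields.YangMills.Theorems.UV3TowerOfACSmallFactorsAdm (card_filter_regionT_le_four')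
open Summit.QuantumFields.YangMills.Theorems.UV3ACLargeFieldEnvelopeAtLevel (Zterm_towerOfAC_le_booked)
open Summit.QuantumFields.YangMills.Theorems.UV3BranchExpansionHTopT3EveryLevel (massRecP_avT3_le_exp_ae_of_level)
open Summit.QuantumFields.YangMills.Theorems.AlphaV4AC

/-! ## §1 The small-factors leaf (67)–(71) on admissible histories, from the currency-free (71)-row -/

section Lane

variable {L : ℕ} {S : Scales L} {G : Type} [GaugeGroup G] [MeasurableSpace G] [HaarData G] {𝔊 : GroupModel G} {𝔠 : AlphaConsts L 𝔊.N}
  {X : ExternalInputsAC S G} {𝔖 : ∀ k, StepSeries S G ↥(lieC 𝔊) (nblkOf S 𝔠.lane.carrier k) k} {𝔄 : AlphaDataAC 𝔊 𝔠 X 𝔖}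
  {win : (k : ℕ) → Hist S.P (k + 1) → Set (GaugeField S.P (k + 1) G)}

/-- ★ **THE SMALL-FACTORS LEAF (67)–(71) ON ADMISSIBLE HISTORIES FOR THE AC TOWER OF A VERSION-4 CORE RUN** (rows twin of ✓`smallFactorsAdm_towerOfAC_v3`, `c₁ = 1∕(4N)`):
`adm h → (1∕(4N))·Σ_{e∈P(h)} p(g_{e.1})²∕4 ≤ mainT_k(h, U)` — per recorded plaquette the ROW `RunAlphaV4CoreAC.h71` ((71), currency-free; no coupling window and no `2 ≤ L` needed), globally
the multiplicity `≤ 4` of the regions (`card_filter_regionT_le_four'`) and double counting (`LargeFieldKnit.sum_sum_mem_le_mul_sum`). [cite: Balaban1985UV3, (67)–(71) p.273] -/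
theorem smallFactorsAdm_towerOfAC_v4Core (R : RunAlphaV4CoreAC 𝔊 𝔠 X 𝔖 𝔄 win) :
    ∀ k, k ≤ S.K → ∀ (U : GaugeField S.P k G) (h : Hist S.P k),
      Hist.Admissible 𝔠.lane.carrier.M₁ (rcolOf S 𝔠.lane.carrier) k h →
        1 / (4 * (𝔊.N : ℝ)) * ∑ e ∈ Hist.disc h, B10.pFun 𝔠.lane.carrier.b₀ 𝔠.lane.carrier.p₀ (S.gk e.1) ^ 2 / 4 ≤
          (towerOfAC 𝔠.lane X 𝔖).mainT k h U := by
  intro k hk U h hh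
  classical
  have hkP : k ≤ S.P.m + S.P.K := by show k ≤ S.m + S.K; omega
  have hN : (0 : ℝ) < 𝔊.N := by exact_mod_cast 𝔊.N_pos
  set act : Plaq S.P 0 → ℝ := fun q => (S.eta k)⁻¹ * (1 - reTr (GaugeField.plaqHol (X.UkH k h U) q)) with hact
  have heta : 0 < S.eta k := by
    show 0 < ((S.P.L : ℝ)⁻¹) ^ k
    exact pow_pos (inv_pos.mpr (by exact_mod_cast S.P.L_pos)) k
  have hact0 : ∀ q, 0 ≤ act q := fun q =>
    mul_nonneg (inv_nonneg.mpr heta.le) (sub_nonneg.mpr (GaugeGroup.reTr_le_one _))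
  have hmain : (S.gk k)⁻¹ ^ 2 * ∑ q, act q = (towerOfAC 𝔠.lane X 𝔖).mainT k h U := rfl
  have h71 : ∀ e ∈ Hist.disc h, B10.pFun 𝔠.lane.carrier.b₀ 𝔠.lane.carrier.p₀ (S.gk e.1) ^ 2 / 4 ≤
      (𝔊.N : ℝ) * ((S.gk k)⁻¹ ^ 2 * ∑ q ∈ regionT (S := S) e, act q) :=
    fun e he => R.h71 k hk h hh U e he
  have hsum : ∑ e ∈ Hist.disc h, B10.pFun 𝔠.lane.carrier.b₀ 𝔠.lane.carrier.p₀ (S.gk e.1) ^ 2 / 4 ≤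
      (𝔊.N : ℝ) * ((S.gk k)⁻¹ ^ 2 * ∑ e ∈ Hist.disc h, ∑ q ∈ regionT (S := S) e, act q) := by
    calc ∑ e ∈ Hist.disc h, B10.pFun 𝔠.lane.carrier.b₀ 𝔠.lane.carrier.p₀ (S.gk e.1) ^ 2 / 4
        ≤ ∑ e ∈ Hist.disc h, (𝔊.N : ℝ) * ((S.gk k)⁻¹ ^ 2 * ∑ q ∈ regionT (S := S) e, act q) := Finset.sum_le_sum h71
      _ = (𝔊.N : ℝ) * ((S.gk k)⁻¹ ^ 2 * ∑ e ∈ Hist.disc h, ∑ q ∈ regionT (S := S) e, act q) := by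
          rw [Finset.mul_sum, Finset.mul_sum]
  have hdc : ∑ e ∈ Hist.disc h, ∑ q ∈ regionT (S := S) e, act q ≤ (4 : ℕ) * ∑ q, act q :=
    sum_sum_mem_le_mul_sum (Hist.disc h) Finset.univ (regionT (S := S)) act (fun q _ => hact0 q)
      (fun _ _ => Finset.subset_univ _) 4 (fun q _ => card_filter_regionT_le_four' _ _ hkP hh q)
  have hg0 : 0 ≤ (S.gk k)⁻¹ ^ 2 := sq_nonneg _
  calc 1 / (4 * (𝔊.N : ℝ)) * ∑ e ∈ Hist.disc h, B10.pFun 𝔠.lane.carrier.b₀ 𝔠.lane.carrier.p₀ (S.gk e.1) ^ 2 / 4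
      ≤ 1 / (4 * (𝔊.N : ℝ)) * ((𝔊.N : ℝ) * ((S.gk k)⁻¹ ^ 2 * ((4 : ℕ) * ∑ q, act q))) := by
        refine mul_le_mul_of_nonneg_left (hsum.trans ?_) (by positivity)
        exact mul_le_mul_of_nonneg_left (mul_le_mul_of_nonneg_left hdc hg0) hN.le
    _ = (S.gk k)⁻¹ ^ 2 * ∑ q, act q := by
        push_cast
        field_simp
    _ = (towerOfAC 𝔠.lane X 𝔖).mainT k h U := hmain

end Lane

variable {F : T3Family} {𝔠 : AlphaConsts F.L (suGroupModel 2).N} {γ : ℝ} {hγ : 0 < γ} {hγ1 : γ ≤ (min 𝔠.gamma0 1) ^ 2} {K : ℕ}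

/-- **THE SMALL-FACTORS LEAF FOR A ROWS RECORD'S TOWER** (T³ reading of §1 at `p.runRows`): `adm r → (1∕8)·Σ_{e∈P(r)} p(g_{e.1})²∕4 ≤ mainT_k(r, W)` (`1∕(4N) = 1∕8` at `N = 2`).
[cite: Balaban1985UV3, (67)–(71) p.273] -/
theorem smallFactorsAdm_of_coreRows (p : AlphaInputsT3AC.PkgCoreRows F 𝔠 γ hγ hγ1 K) (k : ℕ) (hk : k ≤ K)
    (W : GaugeField (F.P K) k (Matrix.specialUnitaryGroup (Fin 2) ℂ)) (r : Hist (F.P K) k)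
    (hr : Hist.Admissible 𝔠.lane.carrier.M₁ (rcolOf (T3Scales F γ hγ (hγ1.trans (sq_min_one_le _ 𝔠.gamma0_pos)) K) 𝔠.lane.carrier) k r) :
    1 / (4 * ((suGroupModel 2).N : ℝ)) * ∑ e ∈ Hist.disc r,
        B10.pFun 𝔠.lane.carrier.b₀ 𝔠.lane.carrier.p₀ ((T3Scales F γ hγ (hγ1.trans (sq_min_one_le _ 𝔠.gamma0_pos)) K).gk e.1) ^ 2 / 4 ≤
      p.T.mainT k r W :=
  smallFactorsAdm_towerOfAC_v4Core p.runRows k hk W r hr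

/-! ## §2 The enveloped resummation at every level and the a.e. bound of the (41)_k history sum, over the rows record -/

/-- ★★★ **THE UN-PINNED (41)_k HISTORY SUM UNDER A MASS ENVELOPE ON ALL ADMISSIBLE HISTORIES, EVERY LEVEL `k ≤ K` — ROWS EDITION** (✓`all_le_of_massEnvelope_v3_at` VERBATIM over
`PkgCoreRows`, the small factors from §1): for a field `W` with `wtP_k(r, W) ≤ e^{A}` on admissible `r`,
`Σ_r wtP_k(r,W)·e^{−mainT_k(r,W) + Zterm_k(r)} ≤ e^{A}·exp((3∕(½ log L))·#Site(F.P K, k))`. [cite: Balaban1985UV3, (41) p.266, (67)–(71) p.273, pp.273–274] -/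
theorem all_le_of_massEnvelope_rows_at (p : AlphaInputsT3AC.PkgCoreRows F 𝔠 γ hγ hγ1 K) (k : ℕ) (hk : k ≤ K) {A : ℝ}
    (W : GaugeField (F.P K) k (Matrix.specialUnitaryGroup (Fin 2) ℂ))
    (hW : ∀ r : Hist (F.P K) k,
      Hist.Admissible 𝔠.lane.carrier.M₁ (rcolOf (T3Scales F γ hγ (hγ1.trans (sq_min_one_le _ 𝔠.gamma0_pos)) K) 𝔠.lane.carrier) k r →
      p.wtP k r W ≤ Real.exp A) :
    ∑ r : Hist (F.P K) k, p.wtP k r W * Real.exp (-(p.T.mainT k r W) + p.T.Zterm k r)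
      ≤ Real.exp A * Real.exp (3 / (Real.log F.L / 2) * (Fintype.card (Site (F.P K) k) : ℝ)) := by
  classical
  set S := T3Scales F γ hγ (hγ1.trans (sq_min_one_le _ 𝔠.gamma0_pos)) K with hS
  have hSK : S.K = K := rfl
  have hL : 2 ≤ F.L := F.hL.2
  have hLr : (2 : ℝ) ≤ F.L := by exact_mod_cast hL
  have hR₁ : 0 ≤ 𝔠.lane.carrier.R₁ := 𝔠.R₁_nonneg
  have hr : 0 ≤ 𝔠.lane.carrier.r₀ := le_trans zero_le_one 𝔠.one_le_r₀
  have hM : 0 < 𝔠.lane.carrier.M₁ := 𝔠.lane.F.M₁_pos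
  have hNpos : 0 < (suGroupModel 2).N := (suGroupModel 2).N_pos
  have hg : ∀ i, i ≤ K → 0 < S.gk i ∧ S.gk i ≤ 1 := fun i hi => ⟨gk_pos S i, gk_le_one S S.gK_le_one i hi⟩
  have hlogL : 0 < Real.log F.L := Real.log_pos (by linarith)
  have hℓ : 0 < Real.log (F.L : ℝ) / 2 := by positivity
  -- the progression of the couplings
  have hx : ∀ i, i ≤ K → xlog (S.gk i) = xlog (S.gk K) + ((K - i : ℕ) : ℝ) * (Real.log F.L / 2) := by
    intro i hi
    rw [gk_eq_gRun_norm S i, gk_eq_gRun_norm S K]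
    exact xlog_gRun 1 (F.L : ℝ) S.g0sq one_pos (by linarith) (g0sq_pos S) hi
  -- the sign of `A` and the provisos
  have hAz : 0 ≤ (𝔠.lane.carrier.Cz + 𝔠.lane.carrier.Cv) + 𝔠.lane.carrier.C₅ + 𝔠.lane.carrier.C₆ +
      (|𝔠.lane.carrier.logσ₀| + 𝔠.lane.carrier.dg) * 𝔠.lane.carrier.c₁ := by
    have := 𝔠.lane.carrier.dg_nonneg
    have := abs_nonneg 𝔠.lane.carrier.logσ₀
    have hCz : 0 ≤ 𝔠.lane.carrier.Cz + 𝔠.lane.carrier.Cv := add_nonneg 𝔠.Cz_nonneg 𝔠.Cv_nonneg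
    have h5 : 0 ≤ 𝔠.lane.carrier.C₅ := 𝔠.C₅_nonneg
    have h6 : 0 ≤ 𝔠.lane.carrier.C₆ := 𝔠.C₆_nonneg
    have hc₁ : 0 ≤ 𝔠.lane.carrier.c₁ := by show (0 : ℝ) ≤ 3; norm_num
    positivity
  have hp := prov_hp 𝔠
  have hb₁ := prov_hb₁ 𝔠 hNpos
  have hb₂ := prov_hb₂ 𝔠 hNpos
  have hcL : 𝔠.lane.consts.L = (F.L : ℝ) := rfl
  rw [hcL] at hb₁
  have hMr : (1 : ℝ) ≤ 𝔠.lane.carrier.M₁ := by exact_mod_cast hM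
  have hcg : (0 : ℝ) ≤ (2 * (2 * ((𝔠.lane.carrier.R₁ + 1) * 𝔠.lane.carrier.M₁) +
      2 * ((F.L : ℝ) * (3 * ((𝔠.lane.carrier.M₁ : ℝ) - 1)) + 3 * ((F.L : ℝ) - 1)) + 20)) * 1 := by
    have h1 : (0 : ℝ) ≤ (𝔠.lane.carrier.R₁ + 1) * 𝔠.lane.carrier.M₁ := by positivity
    have h2 : (0 : ℝ) ≤ (F.L : ℝ) * (3 * ((𝔠.lane.carrier.M₁ : ℝ) - 1)) := by nlinarith
    nlinarith
  refine (largeField_enveloped_adm (k := k) (K := K) hk S.gk (b₀ := 𝔠.lane.carrier.b₀) (p₀ := 𝔠.lane.carrier.p₀)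
    (A := (𝔠.lane.carrier.Cz + 𝔠.lane.carrier.Cv) + 𝔠.lane.carrier.C₅ + 𝔠.lane.carrier.C₆ +
      (|𝔠.lane.carrier.logσ₀| + 𝔠.lane.carrier.dg) * 𝔠.lane.carrier.c₁) (A₀ := 0)
    (c₁ := 1 / (4 * ((suGroupModel 2).N : ℝ))) (gs := 1)
    (cg := 2 * (2 * ((𝔠.lane.carrier.R₁ + 1) * 𝔠.lane.carrier.M₁) + 2 * ((F.L : ℝ) * (3 * ((𝔠.lane.carrier.M₁ : ℝ) - 1)) + 3 * ((F.L : ℝ) - 1)) + 20))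
    (ρ := 1) (r₀ := 𝔠.lane.carrier.r₀) (ℓ := Real.log F.L / 2) (xK := xlog (S.gk K)) (S := (Fintype.card (Site (F.P K) k) : ℝ))
    (σ := 3 * Real.log F.L) (Menv := Real.exp A)
    (allCodes (F.P K) k) (fun e he => Hist.disc_lt _ e he) ?cardE
    (Finset.univ : Finset (Hist (F.P K) k))
    (Hist.Admissible 𝔠.lane.carrier.M₁ (rcolOf S 𝔠.lane.carrier) k) Hist.disc
    (fun r _ _ => Hist.disc_subset_allCodes r) ((Hist.disc_injective k).injOn.mono (Set.subset_univ _))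
    (fun r => p.wtP k r W) (fun r => p.T.mainT k r W) (fun r => p.T.Zterm k r)
    (fun i Q => ∑ e ∈ Q.filter (fun e => e.1 ≤ i),
      (2 * (2 * ((𝔠.lane.carrier.R₁ + 1) * 𝔠.lane.carrier.M₁) + 2 * ((F.L : ℝ) * (3 * ((𝔠.lane.carrier.M₁ : ℝ) - 1)) + 3 * ((F.L : ℝ) - 1)) + 20) * 1) ^ 3 *
        xlog (S.gk e.1) ^ (3 * 𝔠.lane.carrier.r₀))
    (Real.exp_pos _).le ?madm ?menv ?sf ?zt (fun Q _ i _ => le_rfl)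
    hAz le_rfl (by positivity) hcg hr hℓ (Nat.cast_nonneg _) hg le_rfl hx hp ?b1 ?b2).1
  case cardE =>
    intro i hi
    have hPL : (F.P K).L = F.L := rfl
    have h := card_filter_allCodes_le_exp (P := F.P K) rfl hi (by show k ≤ F.m + K; omega)
    rw [hPL] at h
    exact h
  case madm =>
    intro r _ hna
    exact PinnedStep.wtP_eq_zero_of_not_admissible 𝔠.lane p.X (AlphaInputsT3AC.admWindowT3 F 𝔠 γ hγ hγ1 K) k r W hna
  case menv =>
    intro r _ hadm
    rw [zero_mul, Real.exp_zero, mul_one]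
    exact hW r hadm
  case sf =>
    intro r _ hadm
    exact smallFactorsAdm_of_coreRows p k hk W r hadm
  case zt =>
    intro r _ _
    exact Zterm_towerOfAC_le_booked (hγ1 := hγ1) p.X p.𝔖 k hk r
  case b1 =>
    simpa using hb₁
  case b2 =>
    nlinarith [hb₂, hlogL]

/-- ★★★ **THE (41)_k LARGE-FIELD HISTORY SUM UNDER ANY LEVEL-`k` a.e. MASS ENVELOPE — ROWS EDITION**: if every pinned mass `massP_k(r, ·)` is `≤ e^{M}` almost everywhere, then
`dU_k^{(K)}`-almost every `W` has `Σ_r wtP_k(r, W)·exp(−mainT_k(r, W) + Zterm_k(r)) ≤ e^{M}·exp((3∕(½ log L))·#Site(F.P K, k))` (`wtP ≤ massP`, `PinnedStep.wtP_nonneg_le`; then §2).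
[cite: Balaban1985UV3, (5) p.256, (41) p.266, (67)–(71) p.273, pp.273–274] -/
theorem lfSum_le_exp_ae_of_massEnvelope_rows (p : AlphaInputsT3AC.PkgCoreRows F 𝔠 γ hγ hγ1 K) (k : ℕ) (hk : k ≤ K) {M : ℝ}
    (hmass : ∀ r : Hist (F.P K) k, ∀ᵐ W ∂fieldMeasure (F.P K) k (Matrix.specialUnitaryGroup (Fin 2) ℂ),
      PinnedStep.massP 𝔠.lane p.X k r W ≤ Real.exp M) :
    ∀ᵐ W ∂fieldMeasure (F.P K) k (Matrix.specialUnitaryGroup (Fin 2) ℂ),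
      ∑ r : Hist (F.P K) k, p.wtP k r W * Real.exp (-(p.T.mainT k r W) + p.T.Zterm k r)
        ≤ Real.exp M * Real.exp (3 / (Real.log F.L / 2) * (Fintype.card (Site (F.P K) k) : ℝ)) := by
  have hae : ∀ᵐ W ∂(fieldMeasure (F.P K) k (Matrix.specialUnitaryGroup (Fin 2) ℂ)), ∀ r : Hist (F.P K) k,
      PinnedStep.massP 𝔠.lane p.X k r W ≤ Real.exp M := ae_all_iff.2 hmass
  filter_upwards [hae] with W hW
  refine all_le_of_massEnvelope_rows_at p k hk W fun r _ => ?_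
  exact (PinnedStep.wtP_nonneg_le 𝔠.lane p.X (AlphaInputsT3AC.admWindowT3 F 𝔠 γ hγ hγ1 K) k r W).2.trans (hW r)

/-- ★★★ **THE (41)_k LARGE-FIELD HISTORY SUM IS K-UNIFORMLY ESSENTIALLY BOUNDED AT EVERY LEVEL, CONDITIONAL ON A ROWS RECORD ONLY** — the row `hlf` of Theorem 1's upper bound
at every `k ≤ K`, NO displayed letter, for EVERY socket version: for every three-torus family there is `A ≥ 0` (the hTop mass envelope at every level,
✓`massRecP_avT3_le_exp_ae_of_level`) such that for every rows record at any `(γ, K)` and every `k ≤ K`, `dU_k^{(K)}`-almost every `W` has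
`Σ_r wtP_k(r, W)·exp(−mainT_k(r, W) + Zterm_k(r)) ≤ exp(#PBond(F.P K) k·A + (3∕(½ log L))·#Site(F.P K, k))` — at `k = K − n` both counts are the height-`n` counts, K-FREE.
[cite: Balaban1985UV3, (5) p.256, (41) p.266, pp.273–274] -/
theorem exists_lfSum_le_exp_ae_rows (F : T3Family) :
    ∃ A : ℝ, 0 ≤ A ∧ ∀ (𝔠 : AlphaConsts F.L (suGroupModel 2).N) (γ : ℝ) (hγ : 0 < γ) (hγ1 : γ ≤ (min 𝔠.gamma0 1) ^ 2) (K : ℕ)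
      (p : AlphaInputsT3AC.PkgCoreRows F 𝔠 γ hγ hγ1 K) (k : ℕ), k ≤ K →
      ∀ᵐ W ∂fieldMeasure (F.P K) k (Matrix.specialUnitaryGroup (Fin 2) ℂ),
        ∑ r : Hist (F.P K) k, p.wtP k r W * Real.exp (-(p.T.mainT k r W) + p.T.Zterm k r)
          ≤ Real.exp ((Fintype.card (PBond (F.P K) k) : ℝ) * A + 3 / (Real.log F.L / 2) * (Fintype.card (Site (F.P K) k) : ℝ)) := by
  obtain ⟨A, hA, hmass⟩ := massRecP_avT3_le_exp_ae_of_level F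
  refine ⟨A, hA, fun 𝔠 γ hγ hγ1 K p k hk => ?_⟩
  filter_upwards [lfSum_le_exp_ae_of_massEnvelope_rows p k hk (fun r => hmass K k (by omega) _ _ _ _ r)] with W hW
  rw [Real.exp_add]
  exact hW

/-! ## §3 Read at the v4 χ-package (the socket the 19936 registry's stubs deliver)

Consistency with the v3 edition: at a v3 package `p : AlphaInputsT3AC.PkgAtV3`, §2 at `p.toCore.toRows` is the statement of
✓`UV3ACLargeFieldEnvelopeAtLevel.exists_lfSum_le_exp_ae` LETTER FOR LETTER (the gate's dedup confirms it; not re-declared here). -/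

/-- **THE (41)_k LARGE-FIELD HISTORY SUM BOUND AT THE v4 χ-PACKAGE** `AlphaInputsT3AC.PkgAtV4Chi` (§2 at `p.toRows`; the weights, tower and masses of `p.toRows` are those of `p` by `rfl`).
[cite: Balaban1985UV3, (5) p.256, (41) p.266, pp.273–274] -/
theorem exists_lfSum_le_exp_ae_v4Chi (F : T3Family) :
    ∃ A : ℝ, 0 ≤ A ∧ ∀ (𝔠 : AlphaConsts F.L (suGroupModel 2).N) (γ : ℝ) (hγ : 0 < γ) (hγ1 : γ ≤ (min 𝔠.gamma0 1) ^ 2) (K : ℕ)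
      (p : AlphaInputsT3AC.PkgAtV4Chi F 𝔠 γ hγ hγ1 K) (k : ℕ), k ≤ K →
      ∀ᵐ W ∂fieldMeasure (F.P K) k (Matrix.specialUnitaryGroup (Fin 2) ℂ),
        ∑ r : Hist (F.P K) k, p.toRows.wtP k r W * Real.exp (-(p.toRows.T.mainT k r W) + p.toRows.T.Zterm k r)
          ≤ Real.exp ((Fintype.card (PBond (F.P K) k) : ℝ) * A + 3 / (Real.log F.L / 2) * (Fintype.card (Site (F.P K) k) : ℝ)) := by
  obtain ⟨A, hA, h⟩ := exists_lfSum_le_exp_ae_rows F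
  exact ⟨A, hA, fun 𝔠 γ hγ hγ1 K p k hk => h 𝔠 γ hγ hγ1 K p.toRows k hk⟩

end Summit.QuantumFields.YangMills.Theorems.UV3ACLargeFieldEnvelopeRows

end
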